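import Literature.MathematicalPhysics.QuantumFieldTheory.QuasiLocalGaugePerturbation
import Literature.MathematicalPhysics.QuantumFieldTheory.LatticeGaugeProofs
import HarnessLib

/-!
# Quasi-local gauge-invariant perturbations, V: translation invariance and covariances

Fifth file on the tree's `QuasiLocalGaugePerturbation d L G b` (after `QuasiLocalGaugePerturbation`,
`…Wilson`, `…Locality`, `…Kernels`). The tree's connected Euclidean-time correlation
`W.connectedCorr ρ β A B n = ⟨A · τ_n B⟩_{β,W} - ⟨A⟩_{β,W} ⟨B⟩_{β,W}` (observables of `ℤ^d` read
through the periodic lift `torusLift`, `τ_n` the time shift `configShift (-n e₀)`) subtracts the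
UNSHIFTED mean of `B`; it is the covariance of `A ∘ torusLift` and `(B ∘ τ_n) ∘ torusLift` only
when the perturbed torus measure `μ_{β,W}` is translation invariant. This file records:

* `QuasiLocalGaugePerturbation.covCorr` — the covariance form
  `⟨A · τ_n B⟩_{β,W} - ⟨A⟩_{β,W} ⟨τ_n B⟩_{β,W}` (the genuinely connected correlation for an
  arbitrary, possibly non-invariant `W`);
* `….perturbedMeasure_map_torusConfigShift` — if the total `W = ∑_X W_X` is invariant under all
  torus translations then so is `μ_{β,W} ∝ e^{-β S_W - W} ∏ dU` (product Haar and the Wilson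
  action are invariant; tree `wilsonMeasure_map_torusConfigShift` is the case `W = 0`);
* `….expectation_configShift_torusLift` — hence `⟨F ∘ τ_z⟩_{β,W} = ⟨F⟩_{β,W}` for lifted
  observables, and `….connectedCorr_eq_covCorr` — `connectedCorr = covCorr` for such `W`;
* `dependsOn_comp_torusLift`, `dependsOn_comp_configShift_torusLift` — a (shifted) cylinder
  observable of `ℤ^d` read through the lift depends only on the links carrying the cells of its
  (shifted) support, for any labelling `cell` of the torus links (the locality input of covariance
  bounds for `covCorr`).

Imports: `LatticeGaugeProofs` (not in the cone of `QuasiLocalGaugePerturbation` since the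
`TorusConfigShift` leaf repair) is needed for `wilsonAction_torusConfigShift`,
`withDensity_map_of_measurableEquiv` and `toTorusObservable_comp_configShift`.
Sources: K. Osterwalder, E. Seiler, Ann. Phys. 110 (1978) 440, §2 (translation-invariant torus
states, truncated correlations); E. Seiler, LNP 159 (1982), Ch. 2. The statements are folklore.
-/

noncomputable section

open MeasureTheory
open Literature.MathematicalPhysics.QuantumLattice

namespace Literature.MathematicalPhysics.QuantumFieldTheory

section Lift

variable {d N : ℕ} {G : Type*} [MeasurableSpace G]

omit [MeasurableSpace G] in
/-- A cylinder observable read through the periodic lift depends only on the links whose cells are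
cells of its support. [folklore] -/
theorem dependsOn_comp_torusLift {α ι : Type*} [DecidableEq ι] {F : LGConfig d G → α}
    {SF : Finset (ZdEdge d)} (hF : IsCylinder F SF) (cell : Edge d N → ι) :
    DependsOn (fun U : GaugeConfig d N G => F (torusLift N U))
      {v | cell v ∈ SF.image fun e => cell (torusEdge N e)} := by
  intro U V hUV
  refine hF fun e he => ?_
  exact hUV _ (by
    rw [Set.mem_setOf_eq]
    exact Finset.mem_image_of_mem _ (Finset.mem_coe.1 he))

/-- A SHIFTED cylinder observable read through the periodic lift depends only on the links whose
cells are cells of its shifted support. [folklore] -/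
theorem dependsOn_comp_configShift_torusLift {α ι : Type*} [DecidableEq ι] {F : LGConfig d G → α}
    {SF : Finset (ZdEdge d)} (hF : IsCylinder F SF) (cell : Edge d N → ι)
    (z : Literature.Probability.LatticeModels.Site d) :
    DependsOn (fun U : GaugeConfig d N G => F (configShift z (torusLift N U)))
      {v | cell v ∈ SF.image fun e => cell (torusEdge N (e.1 - z, e.2))} := by
  intro U V hUV
  refine hF fun e he => ?_
  rw [configShift_apply, configShift_apply]
  exact hUV _ (by
    rw [Set.mem_setOf_eq]
    exact Finset.mem_image_of_mem _ (Finset.mem_coe.1 he))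

end Lift

namespace QuasiLocalGaugePerturbation

variable {d L N : ℕ} [NeZero L] {G : Type*} [Group G] [MeasurableSpace G] [TopologicalSpace G]
  [IsTopologicalGroup G] [CompactSpace G] [BorelSpace G] {b : ℕ}
  (W : QuasiLocalGaugePerturbation d L G b) (ρ : G →* Matrix (Fin N) (Fin N) ℂ)

/-- **Covariance of `A` and the time-shifted `B` under the perturbed torus measure**:
`⟨A · τ_n B⟩_{β,W} - ⟨A⟩_{β,W} ⟨τ_n B⟩_{β,W}`, observables of `ℤ^d` read through the periodic lift,
`τ_n` the Euclidean time shift by `n` (the tree's `connectedCorr` with the last factor shifted too;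
the two agree for translation-invariant `μ_{β,W}`, `connectedCorr_eq_covCorr`). [folklore] -/
def covCorr [NeZero d] (β : ℝ) (A B : LGConfig d G → ℝ) (n : ℕ) : ℝ :=
  (W.expectation ρ β fun U =>
      A (torusLift L U) * B (configShift (-Pi.single 0 (n : ℤ)) (torusLift L U))) -
    (W.expectation ρ β fun U => A (torusLift L U)) *
      W.expectation ρ β fun U => B (configShift (-Pi.single 0 (n : ℤ)) (torusLift L U))

/-- **Translation invariance of `μ_{β,W}`**: if the total perturbation is invariant under all torus
translations, then `μ_{β,W} ∘ θ_v⁻¹ = μ_{β,W}` (product Haar is permutation invariant, the Wilson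
action is translation invariant). [folklore] -/
theorem perturbedMeasure_map_torusConfigShift (β : ℝ)
    (hinv : ∀ (v : Site d L) (U : GaugeConfig d L G), W.total (torusConfigShift v U) = W.total U)
    (v : Site d L) :
    (W.perturbedMeasure ρ β).map (torusConfigShift v) = W.perturbedMeasure ρ β := by
  -- adapted from `wilsonMeasure_map_torusConfigShift` (LatticeGaugeProofs)
  have hπ : (Measure.pi fun _ : Edge d L => haarProbability G).map
      (torusConfigShift (G := G) v) = Measure.pi fun _ : Edge d L => haarProbability G :=
    (measurePreserving_arrowCongr' (fun _ : Edge d L => haarProbability G)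
      (fun _ : Edge d L => haarProbability G) (torusEdgeShift v) (MeasurableEquiv.refl G)
      fun _ => MeasurePreserving.id _).map_eq
  unfold QuasiLocalGaugePerturbation.perturbedMeasure
  rw [Measure.map_smul]
  congr 1
  unfold QuasiLocalGaugePerturbation.weight
  rw [withDensity_map_of_measurableEquiv _ _ _ hπ]
  intro U
  rw [wilsonAction_torusConfigShift, hinv]

/-- For a perturbation with translation-invariant total, expectations of SHIFTED lifted observables
are the unshifted ones: `⟨F ∘ τ_z ∘ lift⟩_{β,W} = ⟨F ∘ lift⟩_{β,W}` for every `z ∈ ℤ^d`. [folklore] -/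
theorem expectation_configShift_torusLift {V : Type*} [NormedAddCommGroup V] [NormedSpace ℝ V]
    (β : ℝ)
    (hinv : ∀ (v : Site d L) (U : GaugeConfig d L G), W.total (torusConfigShift v U) = W.total U)
    (F : LGConfig d G → V) (z : Literature.Probability.LatticeModels.Site d) :
    (W.expectation ρ β fun U => F (configShift z (torusLift L U))) =
      W.expectation ρ β fun U => F (torusLift L U) := by
  have h : (fun U : GaugeConfig d L G => F (configShift z (torusLift L U))) =
      (fun U => F (torusLift L U)) ∘
        torusConfigShift (Literature.Probability.LatticeModels.Torus.proj L z) :=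
    toTorusObservable_comp_configShift (G := G) L z F
  have hτ : MeasurePreserving
      (torusConfigShift (Literature.Probability.LatticeModels.Torus.proj L z))
      (W.perturbedMeasure ρ β) (W.perturbedMeasure ρ β) :=
    ⟨(torusConfigShift _).measurable, perturbedMeasure_map_torusConfigShift W ρ β hinv _⟩
  unfold QuasiLocalGaugePerturbation.expectation
  rw [h]
  exact hτ.integral_comp' (fun U => F (torusLift L U))

/-- Hence, for a perturbation with translation-invariant total, the tree's `connectedCorr` IS the
covariance `⟨A · τ_n B⟩ - ⟨A⟩⟨τ_n B⟩`. [folklore] -/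
theorem connectedCorr_eq_covCorr [NeZero d] (β : ℝ)
    (hinv : ∀ (v : Site d L) (U : GaugeConfig d L G), W.total (torusConfigShift v U) = W.total U)
    (A B : LGConfig d G → ℝ) (n : ℕ) :
    W.connectedCorr ρ β A B n = W.covCorr ρ β A B n := by
  unfold QuasiLocalGaugePerturbation.connectedCorr covCorr
  rw [expectation_configShift_torusLift W ρ β hinv B]

/-- The covariance form unfolded to integrals against `μ_{β,W}` (the shape in which covariance
bounds for cell-local observables are stated). [folklore] -/
theorem covCorr_eq_integral [NeZero d] (β : ℝ) (A B : LGConfig d G → ℝ) (n : ℕ) :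
    W.covCorr ρ β A B n =
      ∫ U, A (torusLift L U) * B (configShift (-Pi.single 0 (n : ℤ)) (torusLift L U))
          ∂(W.perturbedMeasure ρ β) -
        (∫ U, A (torusLift L U) ∂(W.perturbedMeasure ρ β)) *
          ∫ U, B (configShift (-Pi.single 0 (n : ℤ)) (torusLift L U)) ∂(W.perturbedMeasure ρ β) :=
  rfl

end QuasiLocalGaugePerturbation

end Literature.MathematicalPhysics.QuantumFieldTheory
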